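import Mathlib
import Summits.KontsevichZagierPeriods.KontsevichZagierPeriods.Theorems.SoloInformedKZAlgebra
import Summits.KontsevichZagierPeriods.KontsevichZagierPeriods.Theorems.SoloInformedKZStokesCells
import Literature.NumberTheory.Transcendental.CurvePeriods
import Literature.NumberTheory.Transcendental.SemialgebraicDerivativeProofs
import HarnessLib

/-!
# Solo-informed: Nash paths and the KZ value `κ̃` of a Huber–Wüstholz period symbol

Session s9 of the soloist line `solo-KontsevichZagierPeriods-informed` (file B of the Rung-2 plan,
`paper/rung2-v2.md` §4.1). A path `γ : ℝ → ℂⁿ` is a **Nash path** if, on some open interval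
`(−ε, 1 + ε)` with `ε ∈ ℚ_{>0}`, it is `C¹` and the real and imaginary parts of its coordinates are
`ℚ`-semialgebraic functions. For a period symbol `s = (Z, ω, γ)` (`CurvePeriods.PeriodSymbol`) whose
path is Nash, the integrand `t ↦ Σᵢ ωᵢ(γ(t)) γᵢ′(t)` of `∫_γ ω` has `ℚ`-semialgebraic, continuous
real and imaginary parts on `[0, 1]` (polynomials with algebraic coefficients in the coordinates and
their derivatives; derivatives of one-variable semialgebraic functions are semialgebraic,
Basu–Pollack–Roy Prop. 3.22 = `IsSemialgebraicFunOn.hasDerivAt_isSemialgebraic_holds`), so that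
`κ̃(s) := (⟦[[0,1], Re(ω(γ)γ′)]⟧, ⟦[[0,1], Im(ω(γ)γ′)]⟧) ∈ V = P × P`
is a pair of classes of genuine Kontsevich–Zagier integral representations, with
`evalP (κ̃ s).fst = Re ∫_γ ω` (`soloInformed_evalP_kappaTilde_fst`).

References: Kontsevich–Zagier 2001 §1 [KontsevichZagier2001]; Huber–Wüstholz 2022 §3.3.1, Ch. 12–13
[HuberWuestholz2022]; Basu–Pollack–Roy 2006, Prop. 3.22 [BasuPollackRoy2006].
-/

noncomputable section

open MeasureTheory Set MvPolynomial
open Literature.NumberTheory.Transcendental Literature.NumberTheory.Transcendental.KZ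
open Literature.NumberTheory.Transcendental.CurvePeriods
open Literature.ModelTheory.ExponentialFields

namespace Summit.KontsevichZagierPeriods.KontsevichZagierPeriods.Theorems

/-! ## 1. Complex-valued functions with semialgebraic real and imaginary parts -/

/-- `F : ℝᵐ ⊇ s → ℂ` has `ℚ`-semialgebraic real and imaginary parts on `s`. -/
def SoloInformedReImSA {m : ℕ} (s : Set (Fin m → ℝ)) (F : (Fin m → ℝ) → ℂ) : Prop :=
  IsSemialgebraicFunOn ℚ s (fun x => (F x).re) ∧ IsSemialgebraicFunOn ℚ s (fun x => (F x).im)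

namespace SoloInformedReImSA

variable {m : ℕ} {s : Set (Fin m → ℝ)} {F G : (Fin m → ℝ) → ℂ}

/-- Restriction to a semialgebraic subset. -/
theorem mono (hF : SoloInformedReImSA s F) {s' : Set (Fin m → ℝ)} (h : s' ⊆ s)
    (hs' : IsSemialgebraic ℚ s') : SoloInformedReImSA s' F :=
  ⟨hF.1.mono h hs', hF.2.mono h hs'⟩

/-- Change of the function on the set. -/
theorem congr (hF : SoloInformedReImSA s F) (h : ∀ x ∈ s, F x = G x) : SoloInformedReImSA s G :=
  ⟨hF.1.congr fun x hx => by show (F x).re = (G x).re; rw [h x hx],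
    hF.2.congr fun x hx => by show (F x).im = (G x).im; rw [h x hx]⟩

/-- Algebraic constants. -/
theorem const (hs : IsSemialgebraic ℚ s) {c : ℂ} (hc : IsAlgebraic ℚ c) :
    SoloInformedReImSA s (fun _ => c) :=
  re_im_const hs (isAlgebraic_re_im hc).1 (isAlgebraic_re_im hc).2

/-- Sums. -/
theorem add (hF : SoloInformedReImSA s F) (hG : SoloInformedReImSA s G) :
    SoloInformedReImSA s (fun x => F x + G x) :=
  re_im_add hF hG

/-- Products. -/
theorem mul (hF : SoloInformedReImSA s F) (hG : SoloInformedReImSA s G) :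
    SoloInformedReImSA s (fun x => F x * G x) :=
  re_im_mul hF hG

/-- Powers. -/
theorem pow (hs : IsSemialgebraic ℚ s) (hF : SoloInformedReImSA s F) (n : ℕ) :
    SoloInformedReImSA s (fun x => F x ^ n) := by
  induction n with
  | zero => simpa using const hs isAlgebraic_one
  | succ n ih => simpa [pow_succ] using ih.mul hF

/-- Finite sums. -/
theorem sum (hs : IsSemialgebraic ℚ s) {ι : Type*} (T : Finset ι) {F : ι → (Fin m → ℝ) → ℂ}
    (hF : ∀ i ∈ T, SoloInformedReImSA s (F i)) :
    SoloInformedReImSA s (fun x => ∑ i ∈ T, F i x) := by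
  classical
  induction T using Finset.induction_on with
  | empty => simpa using const hs isAlgebraic_zero
  | insert a T ha ih =>
    have h := (hF a (by simp)).add (ih fun i hi => hF i (by simp [hi]))
    exact h.congr fun x _ => by rw [Finset.sum_insert ha]

/-- Finite products. -/
theorem prod (hs : IsSemialgebraic ℚ s) {ι : Type*} (T : Finset ι) {F : ι → (Fin m → ℝ) → ℂ}
    (hF : ∀ i ∈ T, SoloInformedReImSA s (F i)) :
    SoloInformedReImSA s (fun x => ∏ i ∈ T, F i x) := by
  classical
  induction T using Finset.induction_on with
  | empty => simpa using const hs isAlgebraic_one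
  | insert a T ha ih =>
    have h := (hF a (by simp)).mul (ih fun i hi => hF i (by simp [hi]))
    exact h.congr fun x _ => by rw [Finset.prod_insert ha]

/-- **Polynomials with algebraic coefficients in functions with semialgebraic real and imaginary
parts have semialgebraic real and imaginary parts.** -/
theorem eval_poly (hs : IsSemialgebraic ℚ s) {n : ℕ} {Φ : (Fin m → ℝ) → Fin n → ℂ}
    (hΦ : ∀ i, SoloInformedReImSA s (fun x => Φ x i)) {P : MvPolynomial (Fin n) ℂ}
    (hP : HasAlgCoeffs P) : SoloInformedReImSA s (fun x => eval (Φ x) P) := by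
  have h : SoloInformedReImSA s
      (fun x => ∑ d ∈ P.support, P.coeff d * ∏ i, Φ x i ^ d i) := by
    refine sum hs _ fun d _ => (const hs (hP d)).mul ?_
    exact prod hs _ fun i _ => (hΦ i).pow hs _
  refine h.congr fun x _ => ?_
  conv_rhs => rw [P.as_sum]
  rw [map_sum]
  refine Finset.sum_congr rfl fun d _ => ?_
  rw [eval_monomial, Finsupp.prod_fintype _ _ (fun i => by simp)]

end SoloInformedReImSA

/-! ## 2. Intervals in `ℝ¹` and Nash paths -/

/-- The open interval `(a, b)` as a subset of `ℝ¹` (first-coordinate spelling). -/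
def soloInformedIoo1 (a b : ℝ) : Set (Fin 1 → ℝ) := {t | t 0 ∈ Ioo a b}

/-- Membership in `soloInformedIoo1`. -/
@[simp] theorem soloInformed_mem_Ioo1 {a b : ℝ} {t : Fin 1 → ℝ} :
    t ∈ soloInformedIoo1 a b ↔ t 0 ∈ Ioo a b := Iff.rfl

/-- Open intervals with rational endpoints are `ℚ`-semialgebraic in `ℝ¹`. -/
theorem isSemialgebraic_soloInformedIoo1 (a b : ℚ) :
    IsSemialgebraic ℚ (soloInformedIoo1 (a : ℝ) b) := by
  have h1 := isSemialgebraic_setOf_eval_lt (k := ℚ) (R := ℝ) (C a : MvPolynomial (Fin 1) ℚ) (X 0)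
  have h2 := isSemialgebraic_setOf_eval_lt (k := ℚ) (R := ℝ) (X 0 : MvPolynomial (Fin 1) ℚ) (C b)
  have hset : soloInformedIoo1 (a : ℝ) b =
      {x | aeval x (C a : MvPolynomial (Fin 1) ℚ) < aeval x (X 0 : MvPolynomial (Fin 1) ℚ)} ∩
        {x | aeval x (X 0 : MvPolynomial (Fin 1) ℚ) < aeval x (C b : MvPolynomial (Fin 1) ℚ)} := by
    ext x
    simp [soloInformedIoo1]
  rw [hset]
  exact h1.inter h2

/-- `[0, 1] ⊆ (−ε, 1 + ε)` for `ε > 0`. -/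
theorem soloInformedUnitI_subset_Ioo1 {ε : ℝ} (hε : 0 < ε) :
    soloInformedUnitI ⊆ soloInformedIoo1 (-ε) (1 + ε) := by
  rintro t ⟨h0, h1⟩
  exact ⟨by linarith, by linarith⟩

/-- **Nash path.** `γ : ℝ → ℂⁿ` is `C¹` on an open interval `(−ε, 1 + ε)`, `ε ∈ ℚ_{>0}`, on which
the real and imaginary parts of all its coordinates are `ℚ`-semialgebraic functions (hence `γ` is
real-analytic there: a `C¹` semialgebraic function of one variable is Nash away from finitely many
points, and `C¹` across them — only the two stated properties are used). [Bochnak–Coste–Roy 1998, §8.1] -/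
def SoloInformedIsNashPath {n : ℕ} (γ : ℝ → Fin n → ℂ) : Prop :=
  ∃ ε : ℚ, 0 < ε ∧ ContDiffOn ℝ 1 γ (Ioo (-(ε : ℝ)) (1 + ε)) ∧
    ∀ i, SoloInformedReImSA (soloInformedIoo1 (-(ε : ℝ)) (1 + ε)) (fun t => γ (t 0) i)

/-! ## 3. The integrand of `∫_γ ω` along a Nash path -/

/-- The integrand `t ↦ Σᵢ ωᵢ(γ(t)) · γᵢ′(t)` of the period of a symbol. -/
def soloInformedPathIntegrand (s : PeriodSymbol) (t : ℝ) : ℂ :=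
  ∑ i, eval (s.γ.toFun t) (s.ω i) * deriv (fun u => s.γ.toFun u i) t

/-- The period of a symbol is the integral of its path integrand over `[0, 1]` (definitional). -/
theorem soloInformed_period_eq (s : PeriodSymbol) :
    s.period = ∫ t in (0 : ℝ)..1, soloInformedPathIntegrand s t := rfl

/-- The real part of the derivative of a complex-valued function of a real variable is the
derivative of its real part. -/
theorem soloInformed_re_deriv {φ : ℝ → ℂ} {t : ℝ} (h : DifferentiableAt ℝ φ t) :
    (deriv φ t).re = deriv (fun u => (φ u).re) t := by
  have e : (fun u => (φ u).re) = ⇑Complex.reCLM ∘ φ := by funext u; simp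
  have := (Complex.reCLM.hasFDerivAt.comp_hasDerivAt t h.hasDerivAt).deriv
  rw [e, this]
  simp

/-- The imaginary part of the derivative is the derivative of the imaginary part. -/
theorem soloInformed_im_deriv {φ : ℝ → ℂ} {t : ℝ} (h : DifferentiableAt ℝ φ t) :
    (deriv φ t).im = deriv (fun u => (φ u).im) t := by
  have e : (fun u => (φ u).im) = ⇑Complex.imCLM ∘ φ := by funext u; simp
  have := (Complex.imCLM.hasFDerivAt.comp_hasDerivAt t h.hasDerivAt).deriv
  rw [e, this]
  simp

/-- Along a Nash path, each coordinate is differentiable at every point of `(−ε, 1 + ε)`. -/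
theorem soloInformed_differentiableAt_coord {n : ℕ} {γ : ℝ → Fin n → ℂ} {a b : ℝ}
    (hd : ContDiffOn ℝ 1 γ (Ioo a b)) {u : ℝ} (hu : u ∈ Ioo a b) (i : Fin n) :
    DifferentiableAt ℝ (fun u => γ u i) u := by
  have h1 : DifferentiableAt ℝ γ u :=
    (hd.differentiableOn one_ne_zero u hu).differentiableAt (isOpen_Ioo.mem_nhds hu)
  exact differentiableAt_pi.mp h1 i

/-- Along a Nash path, each coordinate derivative `t ↦ γᵢ′(t)` has semialgebraic real and
imaginary parts on `(−ε, 1 + ε)`. [Basu–Pollack–Roy 2006, Prop. 3.22] -/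
theorem soloInformed_reImSA_deriv {n : ℕ} {γ : ℝ → Fin n → ℂ} {ε : ℚ} (hε : 0 < ε)
    (hd : ContDiffOn ℝ 1 γ (Ioo (-(ε : ℝ)) (1 + ε)))
    (hsa : ∀ i, SoloInformedReImSA (soloInformedIoo1 (-(ε : ℝ)) (1 + ε)) (fun t => γ (t 0) i))
    (i : Fin n) :
    SoloInformedReImSA (soloInformedIoo1 (-(ε : ℝ)) (1 + ε))
      (fun t => deriv (fun u => γ u i) (t 0)) := by
  have hε' : (0 : ℝ) < ε := by exact_mod_cast hε
  have hab : (-(ε : ℝ)) < 1 + ε := by linarith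
  have hdi : ∀ u ∈ Ioo (-(ε : ℝ)) (1 + ε), DifferentiableAt ℝ (fun u => γ u i) u :=
    fun u hu => soloInformed_differentiableAt_coord hd hu i
  have hre : ∀ u ∈ Ioo (-(ε : ℝ)) (1 + ε),
      HasDerivAt (fun u => (γ u i).re) (deriv (fun u => (γ u i).re) u) u := by
    intro u hu
    have h := Complex.reCLM.differentiableAt.comp u (hdi u hu)
    have e : (⇑Complex.reCLM ∘ fun u => γ u i) = fun u => (γ u i).re := by
      funext v; simp
    rw [e] at h
    exact h.hasDerivAt
  have him : ∀ u ∈ Ioo (-(ε : ℝ)) (1 + ε),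
      HasDerivAt (fun u => (γ u i).im) (deriv (fun u => (γ u i).im) u) u := by
    intro u hu
    have h := Complex.imCLM.differentiableAt.comp u (hdi u hu)
    have e : (⇑Complex.imCLM ∘ fun u => γ u i) = fun u => (γ u i).im := by
      funext v; simp
    rw [e] at h
    exact h.hasDerivAt
  refine ⟨?_, ?_⟩
  · have key := IsSemialgebraicFunOn.hasDerivAt_isSemialgebraic_holds (-(ε : ℝ)) (1 + ε)
      (fun u => (γ u i).re) (fun u => deriv (fun u => (γ u i).re) u) hab (hsa i).1 hre
    refine (key : IsSemialgebraicFunOn ℚ (soloInformedIoo1 (-(ε : ℝ)) (1 + ε)) _).congr ?_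
    intro t ht
    exact (soloInformed_re_deriv (hdi (t 0) ht)).symm
  · have key := IsSemialgebraicFunOn.hasDerivAt_isSemialgebraic_holds (-(ε : ℝ)) (1 + ε)
      (fun u => (γ u i).im) (fun u => deriv (fun u => (γ u i).im) u) hab (hsa i).2 him
    refine (key : IsSemialgebraicFunOn ℚ (soloInformedIoo1 (-(ε : ℝ)) (1 + ε)) _).congr ?_
    intro t ht
    exact (soloInformed_im_deriv (hdi (t 0) ht)).symm

/-- **The path integrand of a symbol with Nash path has semialgebraic real and imaginary parts on
`(−ε, 1 + ε)`.** -/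
theorem soloInformed_reImSA_pathIntegrand_Ioo (s : PeriodSymbol) {ε : ℚ} (hε : 0 < ε)
    (hd : ContDiffOn ℝ 1 s.γ.toFun (Ioo (-(ε : ℝ)) (1 + ε)))
    (hsa : ∀ i, SoloInformedReImSA (soloInformedIoo1 (-(ε : ℝ)) (1 + ε)) (fun t => s.γ.toFun (t 0) i)) :
    SoloInformedReImSA (soloInformedIoo1 (-(ε : ℝ)) (1 + ε))
      (fun t => soloInformedPathIntegrand s (t 0)) := by
  have hs := isSemialgebraic_soloInformedIoo1 (-ε) (1 + ε)
  push_cast at hs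
  unfold soloInformedPathIntegrand
  refine SoloInformedReImSA.sum hs _ fun i _ => ?_
  exact (SoloInformedReImSA.eval_poly hs hsa (s.ω_algebraic i)).mul
    (soloInformed_reImSA_deriv hε hd hsa i)

/-- The path integrand of a symbol with `C¹` path on an open interval is continuous there. -/
theorem soloInformed_continuousOn_pathIntegrand (s : PeriodSymbol) {a b : ℝ}
    (hd : ContDiffOn ℝ 1 s.γ.toFun (Ioo a b)) :
    ContinuousOn (soloInformedPathIntegrand s) (Ioo a b) := by
  unfold soloInformedPathIntegrand
  refine continuousOn_finsetSum _ fun i _ => ContinuousOn.mul ?_ ?_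
  · exact (continuous_eval (s.ω i)).comp_continuousOn hd.continuousOn
  · have h := (contDiffOn_pi.mp hd i).continuousOn_deriv_of_isOpen isOpen_Ioo le_rfl
    exact h

/-- Transport of continuity from `ℝ` to the first-coordinate spelling on `ℝ¹`. -/
theorem soloInformed_continuousOn_comp_apply_zero {β : Type*} [TopologicalSpace β] {φ : ℝ → β}
    {a b : ℝ} (h : ContinuousOn φ (Ioo a b)) :
    ContinuousOn (fun t : Fin 1 → ℝ => φ (t 0)) (soloInformedIoo1 a b) :=
  h.comp (continuous_apply 0).continuousOn fun _ ht => ht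

/-! ## 4. The representations `[[0,1], Re(ω(γ)γ′)]`, `[[0,1], Im(ω(γ)γ′)]` and `κ̃` -/

section KappaTilde

variable (s : PeriodSymbol) (h : SoloInformedIsNashPath s.γ.toFun)
include h

/-- Real part of the path integrand is `ℚ`-semialgebraic on `[0, 1]` (Nash path). -/
theorem soloInformed_sa_re_pathIntegrand :
    IsSemialgebraicFunOn ℚ soloInformedUnitI (fun t => (soloInformedPathIntegrand s (t 0)).re) := by
  obtain ⟨ε, hε, hd, hsa⟩ := h
  have hε' : (0 : ℝ) < ε := by exact_mod_cast hε
  exact (soloInformed_reImSA_pathIntegrand_Ioo s hε hd hsa).1.mono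
    (soloInformedUnitI_subset_Ioo1 hε') isSemialgebraic_soloInformedUnitI

/-- Imaginary part of the path integrand is `ℚ`-semialgebraic on `[0, 1]` (Nash path). -/
theorem soloInformed_sa_im_pathIntegrand :
    IsSemialgebraicFunOn ℚ soloInformedUnitI (fun t => (soloInformedPathIntegrand s (t 0)).im) := by
  obtain ⟨ε, hε, hd, hsa⟩ := h
  have hε' : (0 : ℝ) < ε := by exact_mod_cast hε
  exact (soloInformed_reImSA_pathIntegrand_Ioo s hε hd hsa).2.mono
    (soloInformedUnitI_subset_Ioo1 hε') isSemialgebraic_soloInformedUnitI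

/-- The path integrand is continuous on `[0, 1]` (Nash path), in the `ℝ¹` spelling. -/
theorem soloInformed_continuousOn_pathIntegrand_unitI :
    ContinuousOn (fun t : Fin 1 → ℝ => soloInformedPathIntegrand s (t 0)) soloInformedUnitI := by
  obtain ⟨ε, hε, hd, hsa⟩ := h
  have hε' : (0 : ℝ) < ε := by exact_mod_cast hε
  have hc := soloInformed_continuousOn_comp_apply_zero (soloInformed_continuousOn_pathIntegrand s hd)
  exact hc.mono (soloInformedUnitI_subset_Ioo1 hε')

/-- Real part of the path integrand is continuous on `[0, 1]` (Nash path). -/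
theorem soloInformed_continuousOn_re_pathIntegrand :
    ContinuousOn (fun t : Fin 1 → ℝ => (soloInformedPathIntegrand s (t 0)).re) soloInformedUnitI :=
  Complex.continuous_re.comp_continuousOn (soloInformed_continuousOn_pathIntegrand_unitI s h)

/-- Imaginary part of the path integrand is continuous on `[0, 1]` (Nash path). -/
theorem soloInformed_continuousOn_im_pathIntegrand :
    ContinuousOn (fun t : Fin 1 → ℝ => (soloInformedPathIntegrand s (t 0)).im) soloInformedUnitI :=
  Complex.continuous_im.comp_continuousOn (soloInformed_continuousOn_pathIntegrand_unitI s h)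

/-- **`[[0,1], Re(ω(γ)γ′)]`**, a Kontsevich–Zagier integral representation (Nash path). -/
def soloInformedPathRepRe : IntegralRep 1 :=
  soloInformedIRep _ (soloInformed_sa_re_pathIntegrand s h) (soloInformed_continuousOn_re_pathIntegrand s h)

/-- **`[[0,1], Im(ω(γ)γ′)]`**, a Kontsevich–Zagier integral representation (Nash path). -/
def soloInformedPathRepIm : IntegralRep 1 :=
  soloInformedIRep _ (soloInformed_sa_im_pathIntegrand s h) (soloInformed_continuousOn_im_pathIntegrand s h)

/-- Domain of `[[0,1], Re(ω(γ)γ′)]`. -/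
@[simp] theorem soloInformedPathRepRe_domain : (soloInformedPathRepRe s h).domain = soloInformedUnitI := rfl

/-- Integrand of `[[0,1], Re(ω(γ)γ′)]`. -/
@[simp] theorem soloInformedPathRepRe_integrand :
    (soloInformedPathRepRe s h).integrand = fun t => (soloInformedPathIntegrand s (t 0)).re := rfl

/-- Domain of `[[0,1], Im(ω(γ)γ′)]`. -/
@[simp] theorem soloInformedPathRepIm_domain : (soloInformedPathRepIm s h).domain = soloInformedUnitI := rfl

/-- Integrand of `[[0,1], Im(ω(γ)γ′)]`. -/
@[simp] theorem soloInformedPathRepIm_integrand :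
    (soloInformedPathRepIm s h).integrand = fun t => (soloInformedPathIntegrand s (t 0)).im := rfl

/-- **`κ̃(s) = (⟦[[0,1], Re(ω(γ)γ′)]⟧, ⟦[[0,1], Im(ω(γ)γ′)]⟧) ∈ V`** for a symbol with Nash path. -/
def soloInformedKappaTilde : SoloInformedV :=
  SoloInformedV.mk (toFormalPeriod (of (soloInformedPathRepRe s h)))
    (toFormalPeriod (of (soloInformedPathRepIm s h)))

/-- First component of `κ̃(s)`. -/
@[simp] theorem soloInformedKappaTilde_fst :
    (soloInformedKappaTilde s h).fst = toFormalPeriod (of (soloInformedPathRepRe s h)) := rfl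

/-- Second component of `κ̃(s)`. -/
@[simp] theorem soloInformedKappaTilde_snd :
    (soloInformedKappaTilde s h).snd = toFormalPeriod (of (soloInformedPathRepIm s h)) := rfl

omit h in
/-- `[0, 1] ⊆ ℝ¹` is the preimage of `[0, 1] ⊆ ℝ` under `ℝ¹ ≃ ℝ`. -/
theorem soloInformedUnitI_eq_preimage :
    soloInformedUnitI = (MeasurableEquiv.funUnique (Fin 1) ℝ) ⁻¹' Icc (0 : ℝ) 1 := by
  ext u
  simp [MeasurableEquiv.funUnique, soloInformedUnitI, Fin.default_eq_zero]

/-- The value of `[[0,1], Re(ω(γ)γ′)]` is `Re ∫_γ ω`. -/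
theorem soloInformedPathRepRe_value : (soloInformedPathRepRe s h).value = s.period.re := by
  have hmp : MeasurePreserving (MeasurableEquiv.funUnique (Fin 1) ℝ) volume volume :=
    volume_preserving_funUnique (Fin 1) ℝ
  have h1 : (soloInformedPathRepRe s h).value =
      ∫ t in Icc (0 : ℝ) 1, (soloInformedPathIntegrand s t).re := by
    show ∫ u in soloInformedUnitI, (soloInformedPathIntegrand s (u 0)).re = _
    rw [soloInformedUnitI_eq_preimage]
    exact hmp.setIntegral_preimage_emb (MeasurableEquiv.funUnique (Fin 1) ℝ).measurableEmbedding
      (fun t => (soloInformedPathIntegrand s t).re) (Icc (0 : ℝ) 1)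
  obtain ⟨ε, hε, hd, hsa⟩ := h
  have hε' : (0 : ℝ) < ε := by exact_mod_cast hε
  have hcont : ContinuousOn (soloInformedPathIntegrand s) (Icc 0 1) :=
    (soloInformed_continuousOn_pathIntegrand s hd).mono fun t ht =>
      ⟨by linarith [ht.1], by linarith [ht.2]⟩
  have hint : IntegrableOn (soloInformedPathIntegrand s) (Ioc 0 1) :=
    hcont.integrableOn_Icc.mono_set Ioc_subset_Icc_self
  rw [h1, integral_Icc_eq_integral_Ioc, soloInformed_period_eq,
    intervalIntegral.integral_of_le zero_le_one]
  have h2 := integral_re hint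
  simpa using h2

/-- **`evalP (κ̃ s).fst = Re ∫_γ ω`**: the first component of `κ̃` represents the real part of the
period. -/
theorem soloInformed_evalP_kappaTilde_fst :
    evalP (soloInformedKappaTilde s h).fst = s.period.re := by
  rw [soloInformedKappaTilde_fst, evalP_toFormalPeriod_of, soloInformedPathRepRe_value]

end KappaTilde

end Summit.KontsevichZagierPeriods.KontsevichZagierPeriods.Theorems
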